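import Summits.NavierStokesRegularity.FunctionalMining.TopEigGapCoerciveBelowTwo
import Summits.NavierStokesRegularity.FunctionalMining.NegBotEigGapCoercive
import HarnessLib

/-!
# FunctionalMining — Proposition L-λ(η) for the `−λ₃` core on the bottom-gap class, every real `q ≥ 6/5`

HONEST FRAMING. Search for candidate a priori estimates; no regularity claim. Cell `pub-nsfunc`, prove
seat (gen 32). Bookkeeping only: the tree's transport `v ↦ −v` (`NegBotEigGapCoercive`:
`negBotEigMoment_botGapCoercivePos_of_topGap`, `violators_outside_botGap_of_topGap`) applied to the node
`TopEig.topEigGapCoercivePos_of_ge_six_fifths` of `TopEigGapCoerciveBelowTwo` (Proposition L-λ(η) for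
every real `q ≥ 6/5` on the whole top-gap class, prove DERIVATIVES §56). Results, for `6/5 ≤ q` and `η > 0`:
`negBotEigMoment_botGapCoercivePos_of_ge_six_fifths` — `∃ c > 0`, `c·Ψ_q(v) ≤ heatDissipation Ψ_q v` for every
smooth, divergence-free, zero-mean `v` on `T³` with `(1−η)λ₃ ≤ λ₂` pointwise (`Ψ_q = ∫((−λ₃)⁺)^q`); and
SIEVELD's corollary for the rows `ES.neglam3.q`, read against either one-sided node
(`violators_outside_botGap_of_not_pos_of_ge_six_fifths`, `…_of_not_topPos_of_ge_six_fifths`). The tree had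
these for `q ≥ 2` (`…_of_ge_two`). NOT CLAIMED: `q < 6/5`; the one-sided nodes (OPEN); Navier–Stokes regularity.

[ours, bookkeeping]
FILING (prove seat g33, SLOT OWN-B4, requested INBOX l.5708, queued by LEAD (59g) l.5806 / (59m) l.5827): = staged `pub-nsfunc-prove/staged/g32-own/NegBotEigGapCoerciveBelowTwo.lean` 6dce951f4f26a4e4; this line is the only addition.
-/

noncomputable section

namespace Summit.NavierStokesRegularity.FunctionalMining

open Finset MeasureTheory Literature.Analysis Literature.Analysis.FunctionSpaces Literature.Analysis.FunctionSpaces.Torus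

/-- **Proposition L-λ(η) for the `−λ₃` core, every real `q ≥ 6/5`:** on the bottom-gap class
`(1−η)λ₃ ≤ λ₂` (`η > 0`) the heat price of `Ψ_q = ∫((−λ₃)⁺)^q` is coercive, `∃ c > 0` (the `λ₁` node for
`q ≥ 6/5` transported by `v ↦ −v`). [ours] -/
theorem negBotEigMoment_botGapCoercivePos_of_ge_six_fifths {q η : ℝ} (hq : 6 / 5 ≤ q) (hη0 : 0 < η) :
    ∃ c : ℝ, 0 < c ∧ HeatCoerciveOn (fun v : UnitAddTorus (Fin 3) → EuclideanSpace ℝ (Fin 3) =>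
        ∀ x, (1 - η) * torusStrainBotEig v x ≤ torusStrainMidEig v x) (torusNegBotEigMoment q) c :=
  negBotEigMoment_botGapCoercivePos_of_topGap (TopEig.topEigGapCoercivePos_of_ge_six_fifths hq hη0)

/-- **SIEVELD's corollary for the `−λ₃` rows, every real `q ≥ 6/5`:** if `NegBotEigHeatCoercivePos q` fails,
then for every `η > 0` and every small rate there are admissible violators OUTSIDE the bottom-gap class
`(1−η)λ₃ ≤ λ₂`. [ours] -/
theorem violators_outside_botGap_of_not_pos_of_ge_six_fifths {q η : ℝ} (hq : 6 / 5 ≤ q) (hη0 : 0 < η)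
    (hfail : ¬ NegBotEigHeatCoercivePos (d := Fin 3) q) :
    ∃ c₀ : ℝ, 0 < c₀ ∧ ∀ c : ℝ, 0 < c → c ≤ c₀ →
      ∃ v : UnitAddTorus (Fin 3) → EuclideanSpace ℝ (Fin 3), Torus.IsSmooth v ∧ Torus.IsDivFree v ∧
        Torus.HasZeroMean v ∧ ¬ (∀ x, (1 - η) * torusStrainBotEig v x ≤ torusStrainMidEig v x) ∧
        heatDissipation (torusNegBotEigMoment q) v < c * torusNegBotEigMoment q v :=
  violators_outside_botGap_of_topGap (TopEig.topEigGapCoercivePos_of_ge_six_fifths hq hη0) hfail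

/-- The same read against the `λ₁` row (`TopEigHeatCoercivePos q ↔ NegBotEigHeatCoercivePos q` by
`v ↦ −v`), every real `q ≥ 6/5`. [ours, bookkeeping] -/
theorem violators_outside_botGap_of_not_topPos_of_ge_six_fifths {q η : ℝ} (hq : 6 / 5 ≤ q) (hη0 : 0 < η)
    (hfail : ¬ TopEigHeatCoercivePos (d := Fin 3) q) :
    ∃ c₀ : ℝ, 0 < c₀ ∧ ∀ c : ℝ, 0 < c → c ≤ c₀ →
      ∃ v : UnitAddTorus (Fin 3) → EuclideanSpace ℝ (Fin 3), Torus.IsSmooth v ∧ Torus.IsDivFree v ∧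
        Torus.HasZeroMean v ∧ ¬ (∀ x, (1 - η) * torusStrainBotEig v x ≤ torusStrainMidEig v x) ∧
        heatDissipation (torusNegBotEigMoment q) v < c * torusNegBotEigMoment q v :=
  violators_outside_botGap_of_not_pos_of_ge_six_fifths hq hη0 (mt (negBotEigHeatCoercivePos_iff q).1 hfail)

end Summit.NavierStokesRegularity.FunctionalMining

end
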